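import Summits.ResolutionOfSingularities.ResolutionOfSingularities.Theorems.HilbertSamuelEliminationCampaignW42TertiaryCompactnessGeneral
import Summits.ResolutionOfSingularities.ResolutionOfSingularities.Theorems.HilbertSamuelEliminationSigmaMaxModificationsCorridor3MovingCompactnessLeastLabel
import Summits.ResolutionOfSingularities.ResolutionOfSingularities.Theorems.HilbertSamuelEliminationSigmaMaxModificationsCorridor3WLadderMovingDefs
import HarnessLib

/-!
# Route `HilbertSamuelElimination`, crux `SigmaMaxModificationsCorridor3` (stmt-ResolutionOfSingularities-19249;
# child of `SigmaMaxModifications` stmt-…-18506), registered skeleton `w_ladder` v5 MOVING (e55bf4f23146f08b),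
# stub `stub_movingCompactness` (L∞) — the COMPOSITION of idea-2's line `moving-compactness`
# (`L/res-L1-w42-idea-2/Line-moving-compactness.lean` 89d540dcceefd65f) against the TREE's `Moving.MovingCompactness`,
# with helper stubs 1 + 2 discharged: `Moving.MovingCompactness` FROM HELPER STUB 3 ALONE

[OURS · L1 W4.2] (cell res-hironaka, LADDER-RESOLUTION rung L, D-0089; volunteer prover seat res-type-005 gen 6, holder of
helpers 1+2 by res-L1-w42-plan-1 2026-08-27T04:28:23Z). NOT statements of H. Hironaka's manuscript [Hironaka2017]; nothing of
the manuscript is used or asserted. AI-written, weaker than expert review.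

THE CONTENT. idea-2's PROVED composition `movingCompactness_of_stubs` (bounded monotone ⇒ eventually constant; the
least-label dichotomy on the chain of the tree's T∞ `exists_nearChain_of_canonicalSequenceInfinite_general`) restated with
the SAME three hypotheses `h1` `h2` `h3` (verbatim binder types) but concluding the TREE's
`SigmaMaxModificationsCorridor3.Moving.MovingCompactness` (res-type-053, `…Corridor3WLadderMovingDefs`, p496136) instead of
the line's local restatement (definitionally equal; not re-declared here — a parameterless closed `Prop` is declared once),
and `movingCompactness_of_stub3`: `h1`, `h2` DISCHARGED by the landed `stub_leastLabel_monotone` /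
`stub_moving_of_leastLabel_unbounded` (p496952), so that the registered stub closes from helper 3 alone:
`theorem stub_movingCompactness : MovingCompactness.{0} := movingCompactness_of_stub3 (fun … => stub_movingChain_of_leastLabel_eventuallyConst …)`
(a 5-line file once res-type-064's helper 3 lands). No new definition.

## Sources

* V. Cossart, U. Jannsen, S. Saito, *Desingularization: Invariants and Strategy*, LNM 2270 (2020), Rem. 6.29 (1)
  pp. 91–92, p. 105, p. 107. [CossartJannsenSaito2020]
* tree: `CampaignW42.exists_nearChain_of_canonicalSequenceInfinite_general` (…TertiaryCompactnessGeneral),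
  `SigmaMaxModificationsCorridor3.Moving.MovingCompactness` (…WLadderMovingDefs), `leastLabel` / `stub_leastLabel_monotone` /
  `stub_moving_of_leastLabel_unbounded` (…MovingCompactnessLeastLabel).
-/

set_option linter.dupNamespace false -- mandated namespace of this single-conjunct summit

noncomputable section

open CategoryTheory AlgebraicGeometry TopologicalSpace Topology
open Summit.ResolutionOfSingularities.ResolutionOfSingularities.Theorems.CampaignW42
open Literature.AlgebraicGeometry.Resolution Literature.RingTheory.HilbertSamuel
open Summit.ResolutionOfSingularities.ResolutionOfSingularities.Theorems.SigmaMaxModificationsCorridor3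

namespace Summit.ResolutionOfSingularities.ResolutionOfSingularities.Cruxes.SigmaMaxModifications.MovingCompactnessLine

universe u

/-- A bounded monotone `ℕ`-sequence is eventually constant (verbatim the line's). [folklore] -/
theorem eventually_const_of_monotone_of_bounded {f : ℕ → ℕ} (hmono : Monotone f) {B : ℕ} (hB : ∀ n, f n ≤ B) :
    ∃ j n₀, ∀ n, n₀ ≤ n → f n = j := by
  have hfin : (Set.range f).Finite := (Set.finite_Iic B).subset (by rintro _ ⟨n, rfl⟩; exact hB n)
  obtain ⟨_, ⟨n₀, rfl⟩, hmax⟩ := Set.exists_max_image (Set.range f) id hfin ⟨f 0, 0, rfl⟩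
  exact ⟨f n₀, n₀, fun n hn => le_antisymm (hmax _ ⟨n, rfl⟩) (hmono hn)⟩

/-- **COMPOSITION (verbatim the line's `movingCompactness_of_stubs`, concluding the TREE's `Moving.MovingCompactness`):
the three helper stubs give L∞.** On the chain of T∞ (`exists_nearChain_of_canonicalSequenceInfinite_general`) either the
least label present is bounded — monotone (`h1`) hence eventually constant, and `h3` re-marks a MOVING chain — or unbounded,
and the chain itself moves (`h2`). [cite: CossartJannsenSaito2020, Rem. 6.29 (1), p. 105, p. 107] -/
theorem movingCompactness_of_stubs
    (h1 : ∀ {R : ∀ S : Scheme.{u}, CentreSeq S → Prop} {N : ℕ} {ν : ℕ → ℕ} {k : Type u} [Field k],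
      OracleFunctional R → ∀ {X : Scheme.{u}} [IsLocallyNoetherian X], StateGood k R N ν X (Labelling.init X) none →
      ∀ {x : X}, x ∈ Scheme.hsStratum X N ν → IsClosed ({x} : Set X) → ∀ {c : ℕ → MarkedStage.{u}}, c 0 = MarkedStage.init X x → (∀ n, CanonicalNearStep R N ν (c n) (c (n + 1))) →
      Monotone fun n => leastLabel N ν (c n))
    (h2 : ∀ {R : ∀ S : Scheme.{u}, CentreSeq S → Prop} {N : ℕ} {ν : ℕ → ℕ} {k : Type u} [Field k],
      OracleFunctional R → ∀ {X : Scheme.{u}} [IsLocallyNoetherian X], StateGood k R N ν X (Labelling.init X) none →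
      ∀ {x : X}, x ∈ Scheme.hsStratum X N ν → IsClosed ({x} : Set X) → ∀ {c : ℕ → MarkedStage.{u}}, c 0 = MarkedStage.init X x → (∀ n, CanonicalNearStep R N ν (c n) (c (n + 1))) →
      (∀ B, ∃ n, B < leastLabel N ν (c n)) → ∀ n, ∃ m, n ≤ m ∧ (c m).IsBlownUp R N ν)
    (h3 : ∀ {R : ∀ S : Scheme.{u}, CentreSeq S → Prop} {N : ℕ} {ν : ℕ → ℕ} {k : Type u} [Field k],
      OracleFunctional R → ∀ {X : Scheme.{u}} [IsLocallyNoetherian X], StateGood k R N ν X (Labelling.init X) none →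
      ∀ {x : X}, x ∈ Scheme.hsStratum X N ν → IsClosed ({x} : Set X) → ∀ {c : ℕ → MarkedStage.{u}}, c 0 = MarkedStage.init X x → (∀ n, CanonicalNearStep R N ν (c n) (c (n + 1))) →
      (∃ j n₀, ∀ n, n₀ ≤ n → leastLabel N ν (c n) = j) →
      ∃ (x' : X) (c' : ℕ → MarkedStage.{u}), x' ∈ Scheme.hsStratum X N ν ∧ IsClosed ({x'} : Set X) ∧
        c' 0 = MarkedStage.init X x' ∧ (∀ n, CanonicalNearStep R N ν (c' n) (c' (n + 1))) ∧
        ∀ n, ∃ m, n ≤ m ∧ (c' m).IsBlownUp R N ν) :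
    Moving.MovingCompactness.{u} := by
  intro k _ R hRf N ν X _ hgood hinf
  obtain ⟨x, c, hxstr, hxcl, h0, hstep⟩ := exists_nearChain_of_canonicalSequenceInfinite_general hRf hgood hinf
  by_cases hb : ∃ B, ∀ n, leastLabel N ν (c n) ≤ B
  · obtain ⟨B, hB⟩ := hb
    exact h3 hRf hgood hxstr hxcl h0 hstep (eventually_const_of_monotone_of_bounded (h1 hRf hgood hxstr hxcl h0 hstep) hB)
  · push Not at hb
    exact ⟨x, c, hxstr, hxcl, h0, hstep, h2 hRf hgood hxstr hxcl h0 hstep fun B => (hb B)⟩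

/-- **`Moving.MovingCompactness` FROM HELPER STUB 3 ALONE**: the composition with `h1`, `h2` discharged by the landed
`stub_leastLabel_monotone` / `stub_moving_of_leastLabel_unbounded` (p496952). The registered stub `stub_movingCompactness`
follows by applying this to helper 3 (`stub_movingChain_of_leastLabel_eventuallyConst`, res-type-064) at universe `0`.
[cite: CossartJannsenSaito2020, Rem. 6.29 (1), p. 105, p. 107] -/
theorem movingCompactness_of_stub3
    (h3 : ∀ {R : ∀ S : Scheme.{u}, CentreSeq S → Prop} {N : ℕ} {ν : ℕ → ℕ} {k : Type u} [Field k],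
      OracleFunctional R → ∀ {X : Scheme.{u}} [IsLocallyNoetherian X], StateGood k R N ν X (Labelling.init X) none →
      ∀ {x : X}, x ∈ Scheme.hsStratum X N ν → IsClosed ({x} : Set X) → ∀ {c : ℕ → MarkedStage.{u}}, c 0 = MarkedStage.init X x → (∀ n, CanonicalNearStep R N ν (c n) (c (n + 1))) →
      (∃ j n₀, ∀ n, n₀ ≤ n → leastLabel N ν (c n) = j) →
      ∃ (x' : X) (c' : ℕ → MarkedStage.{u}), x' ∈ Scheme.hsStratum X N ν ∧ IsClosed ({x'} : Set X) ∧
        c' 0 = MarkedStage.init X x' ∧ (∀ n, CanonicalNearStep R N ν (c' n) (c' (n + 1))) ∧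
        ∀ n, ∃ m, n ≤ m ∧ (c' m).IsBlownUp R N ν) :
    Moving.MovingCompactness.{u} :=
  movingCompactness_of_stubs
    (fun hRf _ _ hgood _ hx hxcl _ h0 hstep => stub_leastLabel_monotone hRf hgood hx hxcl h0 hstep)
    (fun hRf _ _ hgood _ hx hxcl _ h0 hstep hunb => stub_moving_of_leastLabel_unbounded hRf hgood hx hxcl h0 hstep hunb)
    h3

end Summit.ResolutionOfSingularities.ResolutionOfSingularities.Cruxes.SigmaMaxModifications.MovingCompactnessLine

end
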